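import Mathlib
import Summits.ValiantsHypothesis.ValiantsHypothesis.Theorems.ZeroOneTransfer.Negative.TopComponentFree
import Summits.ValiantsHypothesis.ValiantsHypothesis.Theorems.DivisionGapPerCofactorDegreeReductionStubAdditiveCreation
import Literature.Computability.AlgebraicComplexity.PermanentIrreducible
import Literature.Computability.AlgebraicComplexity.StandardFamiliesProofs

/-!
# Crux `DivisionGap.PerCofactorDegreeReduction` (stmt-ValiantsHypothesis-15046), line `Sketch` —
# stub `stub_singleBaseCollapse`: `m` towers on ONE base collapse by grading alone

**Theorem (`stub_singleBaseCollapse`).** Let `n ≥ 1`, `m ≥ 1`, let `z₀, …, z_{m-1}, t ∈ ℝ≥0[x_ij]`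
(`n × n` variables) be nonzero, `e : Fin m → ℕ`, and suppose `per_n ∣ Σ_j z_j · t^{e_j}` over `ℝ`
(after `MvPolynomial.map NNReal.toRealHom`).  Write `top p` for the top homogeneous component of
`p` (the tree's `topComponent 1 p`).  Then either `per_n ∣ top t` over `ℝ`, or there are a nonempty
`S ⊆ Fin m` and `e₀ ≤ e_j` (`j ∈ S`) such that `W := Σ_{j ∈ S} top z_j · (top t)^{e_j − e₀}` is
nonzero, `per_n ∣ W` over `ℝ`, `deg W ≤ max_i deg z_i`, and every surviving exponent is small:
`(e_j − e₀) · deg t ≤ max_i deg z_i` for `j ∈ S`.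

## Proof

Over `ℝ≥0` nothing cancels and there are no zero divisors, so
`D_j := deg (z_j t^{e_j}) = deg z_j + e_j · deg t ≤ D := deg (Σ_j z_j t^{e_j})`, with equality
on the nonempty set `S := {j | D_j = D}` (`totalDegree_finsetSum`).  The degree-`D` homogeneous
component of the sum is `G := Σ_{j ∈ S} top z_j · (top t)^{e_j}` (summands with `D_j < D` contribute
nothing, `homogeneousComponent_eq_zero`; for `j ∈ S` the component is the top component of the
tower, i.e. the tower of top components by `topComponent_mul`).  `per_n` is a form, so every
homogeneous component of a multiple of `per_n` is a multiple of `per_n`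
(`perPoly_dvd_homogeneousComponent_of_dvd`), and `map` commutes with homogeneous components; hence
`per_n ∣ G` over `ℝ`.  With `e₀ := min_S e` we have `G = (top t)^{e₀} · W`, and `per_n` is prime in
`ℝ[x]` (`AdditiveCreation.perPoly_prime`), so `per_n ∣ top t` or `per_n ∣ W`.  Finally, for
`j ∈ S`, `deg z_j + (e_j − e₀) deg t = D − e₀ deg t = deg z_{j₀}` where `j₀ ∈ S` attains `e₀`; this
bounds both the exponents and (by `totalDegree_finsetSum_le`, `totalDegree_mul`, `totalDegree_pow`,
`deg (top p) ≤ deg p`) the degree of `W` by `deg z_{j₀} ≤ max_i deg z_i`; and `W ≠ 0` because its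
`j₀`-th summand is nonzero and supports only grow under addition over `ℝ≥0`.

Leans on the tree only: `ZeroOneTransfer.Negative.{topComponent, topComponent_mul,
topComponent_one, topComponent_ne_zero, support_topComponent_subset}`,
`AdditiveCreation.perPoly_prime`, `JerrumSnir.support_add_eq`, `perPoly_isHomogeneous`; Mathlib.
No definitions.
-/

noncomputable section

-- `Summit.ValiantsHypothesis.ValiantsHypothesis.…` is the tree's mandated single-conjunct layout
-- (Problem = Summit), so the duplicated namespace component is intended.
set_option linter.dupNamespace false

namespace Summit.ValiantsHypothesis.ValiantsHypothesis.Theorems.DivisionGap.PerCofactorDegreeReduction.SingleBaseCollapse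

open MvPolynomial Literature.Computability.AlgebraicComplexity
open Summit.ValiantsHypothesis.ValiantsHypothesis.Theorems.ZeroOneTransfer.Negative
open scoped NNReal BigOperators

/-! ### Multiples of the form `per` -/

/-- Every homogeneous component of a multiple of the generic permanent is again a multiple of it,
over any commutative semiring of coefficients (`per` is a form of degree `card ι`). [folklore] -/
theorem perPoly_dvd_homogeneousComponent_of_dvd {ι R : Type*} [Fintype ι] [DecidableEq ι]
    [CommSemiring R] {g : MvPolynomial (ι × ι) R} (h : perPoly ι R ∣ g) (i : ℕ) :
    perPoly ι R ∣ homogeneousComponent i g := by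
  classical
  obtain ⟨q, rfl⟩ := h
  have hper : (perPoly ι R).IsHomogeneous (Fintype.card ι) := perPoly_isHomogeneous
  conv_rhs => rw [← sum_homogeneousComponent q, Finset.mul_sum, map_sum]
  refine Finset.dvd_sum fun j _ => ?_
  have hhom : (perPoly ι R * homogeneousComponent j q) ∈
      homogeneousSubmodule (ι × ι) R (Fintype.card ι + j) :=
    (mem_homogeneousSubmodule _ _).2 (hper.mul (homogeneousComponent_isHomogeneous j q))
  rw [homogeneousComponent_of_mem hhom]
  split_ifs
  · exact dvd_mul_right _ _
  · exact dvd_zero _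

/-! ### No zero divisors and no cancellation over `ℝ≥0` -/

/-- Over `ℝ≥0`, `deg (p ^ k) = k · deg p` for `p ≠ 0`. [folklore] -/
theorem totalDegree_pow_eq {σ : Type*} {p : MvPolynomial σ ℝ≥0} (hp : p ≠ 0) (k : ℕ) :
    (p ^ k).totalDegree = k * p.totalDegree := by
  induction k with
  | zero => rw [pow_zero, totalDegree_one, zero_mul]
  | succ k ih =>
    rw [pow_succ, totalDegree_mul_of_isDomain (pow_ne_zero k hp) hp, ih]
    ring

/-- Over `ℝ≥0` the support of a summand lies in the support of a finite sum. [folklore] -/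
theorem support_subset_support_sum {σ ι : Type*} (s : Finset ι) (f : ι → MvPolynomial σ ℝ≥0)
    {i : ι} (hi : i ∈ s) : (f i).support ⊆ (∑ j ∈ s, f j).support := by
  classical
  rw [← Finset.add_sum_erase s f hi,
    Literature.Barriers.ValiantsHypothesis.JerrumSnir.support_add_eq]
  exact Finset.subset_union_left

/-- Over `ℝ≥0` a finite sum with a nonzero summand is nonzero. [folklore] -/
theorem sum_ne_zero_of_mem {σ ι : Type*} (s : Finset ι) (f : ι → MvPolynomial σ ℝ≥0) {i : ι}
    (hi : i ∈ s) (hf : f i ≠ 0) : ∑ j ∈ s, f j ≠ 0 := by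
  intro h
  have hsub := support_subset_support_sum s f hi
  rw [h, support_zero, Finset.subset_empty, support_eq_empty] at hsub
  exact hf hsub

/-! ### The stub -/

/-- **`stub_singleBaseCollapse` — `m` towers on ONE base collapse by grading alone.**  If
`per_n ∣ Σ_j z_j · t^{e_j}` over `ℝ` (`n ≥ 1`, `m ≥ 1`, all `z_j ≠ 0`, `t ≠ 0`, nonnegative
coefficients), then either `per_n ∣ top t`, or, with `S` the set of towers of top total degree
and `e₀ = min_S e`, the sum `W = Σ_{j ∈ S} top z_j · (top t)^{e_j − e₀}` is a nonzero multiple of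
`per_n` over `ℝ` with `deg W ≤ max_i deg z_i` and `(e_j − e₀) · deg t ≤ max_i deg z_i` on `S`
(`top = topComponent 1`).  No Diophantine input: grading, no cancellation over `ℝ≥0`, and primality
of `per_n` in `ℝ[x]`. [folklore] -/
theorem stub_singleBaseCollapse (n m : ℕ) (hn : 1 ≤ n)
    (z : Fin m → MvPolynomial (Fin n × Fin n) ℝ≥0) (e : Fin m → ℕ)
    (t : MvPolynomial (Fin n × Fin n) ℝ≥0) (hm : 0 < m) (hz : ∀ j, z j ≠ 0) (ht : t ≠ 0)
    (hdvd : perPoly (Fin n) ℝ ∣ MvPolynomial.map NNReal.toRealHom (∑ j, z j * t ^ (e j))) :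
    perPoly (Fin n) ℝ ∣ MvPolynomial.map NNReal.toRealHom
        (Summit.ValiantsHypothesis.ValiantsHypothesis.Theorems.ZeroOneTransfer.Negative.topComponent
          1 t) ∨
    ∃ (S : Finset (Fin m)) (e₀ : ℕ), S.Nonempty ∧ (∀ j ∈ S, e₀ ≤ e j) ∧
      (∀ j ∈ S, (e j - e₀) * t.totalDegree ≤ Finset.univ.sup fun i => (z i).totalDegree) ∧
      (∑ j ∈ S,
        Summit.ValiantsHypothesis.ValiantsHypothesis.Theorems.ZeroOneTransfer.Negative.topComponent
            1 (z j) *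
          Summit.ValiantsHypothesis.ValiantsHypothesis.Theorems.ZeroOneTransfer.Negative.topComponent
            1 t ^ (e j - e₀)) ≠ 0 ∧
      (∑ j ∈ S,
        Summit.ValiantsHypothesis.ValiantsHypothesis.Theorems.ZeroOneTransfer.Negative.topComponent
            1 (z j) *
          Summit.ValiantsHypothesis.ValiantsHypothesis.Theorems.ZeroOneTransfer.Negative.topComponent
            1 t ^ (e j - e₀)).totalDegree ≤ (Finset.univ.sup fun i => (z i).totalDegree) ∧
      perPoly (Fin n) ℝ ∣ MvPolynomial.map NNReal.toRealHom
        (∑ j ∈ S,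
          Summit.ValiantsHypothesis.ValiantsHypothesis.Theorems.ZeroOneTransfer.Negative.topComponent
              1 (z j) *
            Summit.ValiantsHypothesis.ValiantsHypothesis.Theorems.ZeroOneTransfer.Negative.topComponent
              1 t ^ (e j - e₀)) := by
  classical
  have hprime : Prime (perPoly (Fin n) ℝ) := AdditiveCreation.perPoly_prime hn
  -- top components for the unit weight: the top homogeneous component, multiplicative
  have htop : ∀ p : MvPolynomial (Fin n × Fin n) ℝ≥0,
      topComponent 1 p = homogeneousComponent p.totalDegree p := fun p => by
    unfold topComponent
    rw [weightedTotalDegree_one]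
    rfl
  have htpow : ∀ (p : MvPolynomial (Fin n × Fin n) ℝ≥0) (N : ℕ),
      topComponent 1 (p ^ N) = topComponent 1 p ^ N := fun p N => by
    induction N with
    | zero => rw [pow_zero, pow_zero, topComponent_one]
    | succ N ih => rw [pow_succ, pow_succ, topComponent_mul, ih]
  have htdeg : ∀ p : MvPolynomial (Fin n × Fin n) ℝ≥0,
      (topComponent 1 p).totalDegree ≤ p.totalDegree := fun p =>
    totalDegree_le_of_support_subset (support_topComponent_subset 1 p)
  -- the top degree `D` of the relation and the exact degrees of the towers
  obtain ⟨D, hD⟩ : ∃ D, (∑ j, z j * t ^ (e j)).totalDegree = D := ⟨_, rfl⟩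
  have hdeg : ∀ j, (z j * t ^ (e j)).totalDegree = (z j).totalDegree + e j * t.totalDegree :=
    fun j => by rw [totalDegree_mul_of_isDomain (hz j) (pow_ne_zero _ ht), totalDegree_pow_eq ht]
  have hle : ∀ j, (z j).totalDegree + e j * t.totalDegree ≤ D := fun j => by
    rw [← hdeg j, ← hD]
    exact totalDegree_le_of_support_subset
      (support_subset_support_sum Finset.univ (fun i => z i * t ^ (e i)) (Finset.mem_univ j))
  -- the towers of top degree
  set S : Finset (Fin m) :=
    Finset.univ.filter fun j => (z j).totalDegree + e j * t.totalDegree = D with hS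
  have hmemS : ∀ j, j ∈ S ↔ (z j).totalDegree + e j * t.totalDegree = D := fun j => by
    simp [hS]
  have hSne : S.Nonempty := by
    haveI : Nonempty (Fin m) := ⟨⟨0, hm⟩⟩
    obtain ⟨j, -, hj⟩ := Finset.exists_mem_eq_sup (Finset.univ : Finset (Fin m))
      Finset.univ_nonempty fun i => (z i * t ^ (e i)).totalDegree
    refine ⟨j, (hmemS j).2 (le_antisymm (hle j) ?_)⟩
    have h := totalDegree_finsetSum (Finset.univ : Finset (Fin m)) fun i => z i * t ^ (e i)
    rw [hD, hj, hdeg j] at h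
    exact h
  -- the minimal exponent on `S`
  obtain ⟨j₀, hj₀S, hj₀min⟩ := Finset.exists_min_image S e hSne
  have hsup : (z j₀).totalDegree ≤ Finset.univ.sup fun i => (z i).totalDegree :=
    Finset.le_sup (f := fun i => (z i).totalDegree) (Finset.mem_univ j₀)
  -- key arithmetic: on `S` the reduced towers all have degree `deg z_{j₀}`
  have hkey : ∀ j ∈ S,
      (z j).totalDegree + (e j - e j₀) * t.totalDegree = (z j₀).totalDegree := by
    intro j hj
    have h1 := (hmemS j).1 hj
    have h2 := (hmemS j₀).1 hj₀S
    have h3 : e j₀ * t.totalDegree ≤ e j * t.totalDegree :=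
      Nat.mul_le_mul_right _ (hj₀min j hj)
    rw [Nat.sub_mul]
    omega
  -- the degree-`D` component of the relation is the sum of the top towers over `S`
  have hcomp : homogeneousComponent D (∑ j, z j * t ^ (e j)) =
      ∑ j ∈ S, topComponent 1 (z j) * topComponent 1 t ^ (e j) := by
    have h1 : homogeneousComponent D (∑ j, z j * t ^ (e j)) =
        ∑ j, homogeneousComponent D (z j * t ^ (e j)) := map_sum (homogeneousComponent D) _ _
    have h2 : ∑ j ∈ S, homogeneousComponent D (z j * t ^ (e j)) =
        ∑ j, homogeneousComponent D (z j * t ^ (e j)) :=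
      Finset.sum_subset (Finset.subset_univ S) fun j _ hj => by
        refine homogeneousComponent_eq_zero D _ ?_
        rw [hdeg j]
        exact lt_of_le_of_ne (hle j) fun h => hj ((hmemS j).2 h)
    rw [h1, ← h2]
    refine Finset.sum_congr rfl fun j hj => ?_
    have hDj : (z j * t ^ (e j)).totalDegree = D := by rw [hdeg j]; exact (hmemS j).1 hj
    rw [← hDj, ← htop, topComponent_mul, htpow]
  -- hence `per_n` divides that sum over `ℝ` (`per_n` is a form, `map` respects the grading) ...
  have hdvdS : perPoly (Fin n) ℝ ∣ MvPolynomial.map NNReal.toRealHom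
      (∑ j ∈ S, topComponent 1 (z j) * topComponent 1 t ^ (e j)) := by
    have hmap : MvPolynomial.map NNReal.toRealHom (homogeneousComponent D (∑ j, z j * t ^ (e j))) =
        homogeneousComponent D (MvPolynomial.map NNReal.toRealHom (∑ j, z j * t ^ (e j))) := by
      ext d
      simp only [coeff_map, coeff_homogeneousComponent]
      split_ifs
      · rfl
      · exact map_zero _
    rw [← hcomp, hmap]
    exact perPoly_dvd_homogeneousComponent_of_dvd hdvd D
  -- ... and the sum factors as `(top t)^{e₀} · W`
  have hfactor : ∑ j ∈ S, topComponent 1 (z j) * topComponent 1 t ^ (e j) =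
      topComponent 1 t ^ (e j₀) *
        ∑ j ∈ S, topComponent 1 (z j) * topComponent 1 t ^ (e j - e j₀) := by
    rw [Finset.mul_sum]
    refine Finset.sum_congr rfl fun j hj => ?_
    obtain ⟨k, hk⟩ := Nat.exists_eq_add_of_le (hj₀min j hj)
    rw [hk, Nat.add_sub_cancel_left, pow_add]
    ring
  rw [hfactor, map_mul, map_pow] at hdvdS
  rcases hprime.dvd_or_dvd hdvdS with h | h
  · exact Or.inl (hprime.dvd_of_dvd_pow h)
  · refine Or.inr ⟨S, e j₀, hSne, hj₀min, fun j hj => ?_, ?_, ?_, h⟩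
    · -- the exponent window
      have := hkey j hj
      omega
    · -- `W ≠ 0`: its `j₀`-th summand is nonzero
      exact sum_ne_zero_of_mem S _ hj₀S
        (mul_ne_zero (topComponent_ne_zero 1 (hz j₀)) (pow_ne_zero _ (topComponent_ne_zero 1 ht)))
    · -- `deg W ≤ deg z_{j₀} ≤ max_i deg z_i`
      refine totalDegree_finsetSum_le fun j hj => ?_
      calc (topComponent 1 (z j) * topComponent 1 t ^ (e j - e j₀)).totalDegree
          ≤ (topComponent 1 (z j)).totalDegree +
              (topComponent 1 t ^ (e j - e j₀)).totalDegree := totalDegree_mul _ _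
        _ ≤ (z j).totalDegree + (e j - e j₀) * t.totalDegree :=
            add_le_add (htdeg _)
              ((totalDegree_pow _ _).trans (Nat.mul_le_mul_left _ (htdeg t)))
        _ = (z j₀).totalDegree := hkey j hj
        _ ≤ _ := hsup

end Summit.ValiantsHypothesis.ValiantsHypothesis.Theorems.DivisionGap.PerCofactorDegreeReduction.SingleBaseCollapse

end
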